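import Summits.HubbardSuperconductivity.HubbardSuperconductivity.Theorems.KLProgrammeKLRegimeTwoPointAssemblyMatsubaraAllU
import Summits.HubbardSuperconductivity.HubbardSuperconductivity.Theorems.KLProgrammeKLRegimeTwoPointAssemblyDefs
import HarnessLib

/-!
# Route `KLProgramme`, crux K3, child 4 `KLRegimeTwoPointAssembly` — stub `stub_asm_matsubara` (ALL `U`)

Cell gate-hubbard-kl, seat t2.  The registered stub of the child-4 skeleton (`asm-repr`, lead hubbard-kl-r2d-p2,
stmt-HubbardSuperconductivity-19637), verbatim, on the skeleton's object `grassmannRatio` (`…TwoPointAssemblyDefs`):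
the bare Grassmann two-point ratio converges, as the Matsubara cutoff is removed, to the thermal two-point function at the
physical potential `μ + U/2` minus the midpoint correction — for EVERY real `U` (no radius `3e|U|L²βB² < 1`).  It is the
supplier theorem `…Theorems.MatsubaraAllU.tendsto_grassmannTwoPoint_eq_hubbardThermalTwoPoint_sub_allU` (parts A–G,
HOME/t2/MATSUBARA-ALLU-SCOPE.md) read through the definition of `grassmannRatio`.
-/

namespace Summit.HubbardSuperconductivity.HubbardSuperconductivity.Theorems.TwoPointAssembly

set_option linter.dupNamespace false -- summit = problem name (single-conjunct summit), D-0017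

open Filter Topology Literature.MathematicalPhysics.QuantumLattice Literature.Probability.LatticeModels

/-- **`stub_asm_matsubara`** (t2 lineage, ALL `U`): the bare ratio converges, as the Matsubara cutoff is removed, to the
thermal two-point function at the physical potential `μ + U/2` minus the midpoint correction — the tree's
`tendsto_grassmannTwoPoint_eq_hubbardThermalTwoPoint_sub` WITHOUT its smallness `3e|U|L²βB² < 1`
(`MatsubaraAllU.tendsto_grassmannTwoPoint_eq_hubbardThermalTwoPoint_sub_allU`). -/
theorem stub_asm_matsubara : ∀ (L : ℕ) [NeZero L], 3 ≤ L → ∀ (β : ℝ), 0 < β → ∀ (μ U : ℝ) (σ σ' : Fin 2) (x y : Site 2),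
    Tendsto (fun M : ℕ => grassmannRatio L M β U μ σ σ' (Torus.proj L x) (Torus.proj L y)) atTop
      (𝓝 (hubbardThermalTwoPoint β U (μ + U / 2) L x y σ σ' -
        (if σ = σ' ∧ Torus.proj L x = Torus.proj L y then (1 / 2 : ℂ) else 0))) := by
  intro L _ hL β hβ μ U σ σ' x y
  exact MatsubaraAllU.tendsto_grassmannTwoPoint_eq_hubbardThermalTwoPoint_sub_allU hL hβ μ U σ σ' x y

end Summit.HubbardSuperconductivity.HubbardSuperconductivity.Theorems.TwoPointAssembly
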